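import Mathlib.InformationTheory.KullbackLeibler.KLFun
import Mathlib.Analysis.Calculus.Deriv.MeanValue
import Mathlib.Topology.Algebra.InfiniteSum.Real
import Literature.Probability.Entropy.BinaryRelativeEntropy
import HarnessLib

/-!
# Pinsker's inequality on a countable alphabet, in `klFun` currency

Helper for the line `equilibrium-forecast-chain-rule` of the crux
`InformationPercolationEngine.PercolationClosesChaos` (stmt-AtomisticToContinuum-15178), stub
`stub_predictableProjection` (the predictable-projection bound). Pure real analysis on countable sums:

* `two_mul_sq_sub_le_binaryKL` — the **sharp binary Pinsker inequality**
  `2 (a - b)² ≤ kl(a ‖ b)` for `a ∈ [0, 1]`, `b ∈ (0, 1)` (monotonicity of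
  `t ↦ kl(a ‖ t) - 2 (a - t)²` away from `t = a`: its derivative is `(t - a)(1 - 2t)²/(t(1 - t))`);
* `klFun_eq_tangent` — the tangent identity `klFun x = klFun c + log c · (x - c) + c · klFun (x / c)`;
* `mul_klFun_div_le_tsum` — the **log-sum (perspective Jensen) inequality** on a countable set,
  `b · klFun (a / b) ≤ Σ' Q · klFun (P / Q)` for nonnegative summable `P, Q` with sums `a, b` and `Q = 0 ⇒ P = 0`;
* `binaryKL_eq_mul_klFun_add` — `kl(a ‖ b) = b klFun(a/b) + (1 - b) klFun((1 - a)/(1 - b))`;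
* `sq_tsum_abs_sub_le` / `tsum_abs_sub_le_sqrt` — **Pinsker's inequality with the sharp constant** on a
  countable alphabet: `(Σ' |p - q|)² ≤ 2 Σ' q klFun(p/q)` for probability vectors `p ≪ q`;
* `hasSum_cond_klFun` — the one-atom **chain-rule identity**: for nonnegative families `P', Q'` with sums
  `P, Q > 0`, `Σ'_s (Q'_s/Q) klFun((P'_s/P)/(Q'_s/Q)) = (Σ'_s Q'_s klFun(P'_s/Q'_s) - Q klFun(P/Q)) / P`.

## References
* T. M. Cover, J. A. Thomas, *Elements of Information Theory*, 2nd ed. (2006), Lemma 11.6.1 (Pinsker),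
  Theorem 2.7.1 (log-sum inequality).
* Y. Polyanskiy, Y. Wu, *Information Theory: From Coding to Learning* (2024), Ch. 2 and Thm. 7.10.
-/

noncomputable section

namespace Summit.AtomisticToContinuum.HydrodynamicLimit.Theorems.EquilibriumForecastLine

open Real Set InformationTheory Literature.Probability.Entropy

/-! ### The sharp binary Pinsker inequality -/

/-- Sharp binary Pinsker for `0 ≤ a ≤ b < 1`, `0 < b`: `2 (a - b)² ≤ kl(a ‖ b)`. Proof: the function
`g(t) = kl(a ‖ t) - 2 (a - t)²` vanishes at `t = a` and has derivative
`(t - a)(1 - 2t)² / (t (1 - t)) ≥ 0` on `(a, b)`, hence is monotone on `[a, b]`. [folklore] -/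
theorem two_mul_sq_sub_le_binaryKL_of_le {a b : ℝ} (ha : 0 ≤ a) (hab : a ≤ b) (hb : 0 < b)
    (hb1 : b < 1) : 2 * (a - b) ^ 2 ≤ binaryKL a b := by
  rcases hab.eq_or_lt with rfl | hab
  · simp
  set g : ℝ → ℝ := fun t => binaryKL a t - 2 * ((a - t) * (a - t)) with hg
  have hderiv : ∀ t ∈ Set.Ioo a b, HasDerivAt g
      ((-a / t + (1 - a) / (1 - t)) - 2 * ((-1) * (a - t) + (a - t) * (-1))) t := by
    intro t ht
    have ht0 : 0 < t := ha.trans_lt ht.1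
    have ht1 : t < 1 := ht.2.trans hb1
    have h1 : HasDerivAt (fun t => (a - t) * (a - t)) ((-1) * (a - t) + (a - t) * (-1)) t :=
      ((hasDerivAt_id t).const_sub a).mul ((hasDerivAt_id t).const_sub a)
    exact (hasDerivAt_binaryKL a ht0 ht1).sub (h1.const_mul 2)
  have hcont : ContinuousOn g (Set.Icc a b) := by
    refine ContinuousOn.sub ?_ (by fun_prop)
    rcases ha.eq_or_lt with rfl | ha'
    · -- `a = 0`: `kl(0 ‖ t) = log (1 / (1 - t))`, continuous on `[0, b]`
      have key : ∀ t, binaryKL 0 t = Real.log (1 / (1 - t)) := fun t => by simp [binaryKL]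
      have hc : ContinuousOn (fun t : ℝ => Real.log (1 / (1 - t))) (Set.Icc 0 b) := by
        refine ContinuousOn.log ?_ fun t ht => (one_div_pos.2 (sub_pos.2 (ht.2.trans_lt hb1))).ne'
        exact continuousOn_const.div (by fun_prop) fun t ht => (sub_pos.2 (ht.2.trans_lt hb1)).ne'
      exact hc.congr fun t _ => key t
    · have hsub : Set.Icc a b ⊆ Set.Ioo 0 1 := fun t ht => ⟨ha'.trans_le ht.1, ht.2.trans_lt hb1⟩
      exact (continuousOn_binaryKL a).mono hsub
  have hmono : MonotoneOn g (Set.Icc a b) := by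
    refine monotoneOn_of_deriv_nonneg (convex_Icc a b) hcont ?_ ?_
    · rw [interior_Icc]
      exact fun t ht => (hderiv t ht).differentiableAt.differentiableWithinAt
    · rw [interior_Icc]
      intro t ht
      rw [(hderiv t ht).deriv]
      have ht0 : 0 < t := ha.trans_lt ht.1
      have ht1 : t < 1 := ht.2.trans hb1
      have hta : 0 ≤ t - a := by linarith [ht.1]
      have h1t : 0 < 1 - t := by linarith
      have e1 : -a / t + (1 - a) / (1 - t) - 2 * ((-1) * (a - t) + (a - t) * (-1)) =
          (t - a) * (1 - 2 * t) ^ 2 / (t * (1 - t)) := by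
        field_simp
        ring
      rw [e1]
      exact div_nonneg (mul_nonneg hta (sq_nonneg _)) (mul_pos ht0 h1t).le
  have h0 : g a = 0 := by simp [hg]
  have hab' := hmono (Set.left_mem_Icc.2 hab.le) (Set.right_mem_Icc.2 hab.le) hab.le
  rw [h0] at hab'
  have hpos : 0 ≤ binaryKL a b - 2 * ((a - b) * (a - b)) := hab'
  nlinarith [hpos]

/-- **Sharp binary Pinsker inequality**: `2 (a - b)² ≤ kl(a ‖ b)` for `a ∈ [0, 1]`, `b ∈ (0, 1)`
(the case `b ≤ a` follows from `a ≤ b` by the symmetry `kl(1-a ‖ 1-b) = kl(a ‖ b)`). [folklore] -/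
theorem two_mul_sq_sub_le_binaryKL {a b : ℝ} (ha0 : 0 ≤ a) (ha1 : a ≤ 1) (hb0 : 0 < b)
    (hb1 : b < 1) : 2 * (a - b) ^ 2 ≤ binaryKL a b := by
  rcases le_total a b with hab | hba
  · exact two_mul_sq_sub_le_binaryKL_of_le ha0 hab hb0 hb1
  · have h := two_mul_sq_sub_le_binaryKL_of_le (a := 1 - a) (b := 1 - b) (by linarith) (by linarith)
      (by linarith) (by linarith)
    rw [binaryKL_one_sub] at h
    calc 2 * (a - b) ^ 2 = 2 * ((1 - a) - (1 - b)) ^ 2 := by ring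
      _ ≤ binaryKL a b := h

/-! ### The log-sum inequality on a countable set -/

/-- Tangent identity for `klFun` at `c > 0`: `klFun x = klFun c + log c · (x - c) + c · klFun (x / c)`
(the remainder `c klFun(x/c) ≥ 0` is the Bregman divergence). [folklore] -/
theorem klFun_eq_tangent {c : ℝ} (hc : 0 < c) (x : ℝ) :
    klFun x = klFun c + Real.log c * (x - c) + c * klFun (x / c) := by
  by_cases hx : x = 0
  · subst hx
    simp only [klFun, zero_div, zero_mul, zero_sub, sub_zero, zero_add, mul_one, mul_neg]
    ring
  · simp only [klFun]
    rw [Real.log_div hx hc.ne']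
    field_simp
    ring

/-- **Log-sum inequality** (perspective Jensen) on a countable set: for nonnegative summable families
`P, Q` with sums `a, b` and `Q s = 0 ⇒ P s = 0`, `b · klFun (a / b) ≤ Σ' Q s · klFun (P s / Q s)`
(provided the right-hand side is summable). Proof: sum the tangent inequality at `c = a / b`. [folklore] -/
theorem mul_klFun_div_le_tsum {S : Type*} {P Q : S → ℝ} {a b : ℝ} (hP0 : ∀ s, 0 ≤ P s)
    (hQ0 : ∀ s, 0 ≤ Q s) (hP : HasSum P a) (hQ : HasSum Q b) (hac : ∀ s, Q s = 0 → P s = 0)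
    (hsum : Summable fun s => Q s * klFun (P s / Q s)) :
    b * klFun (a / b) ≤ ∑' s, Q s * klFun (P s / Q s) := by
  have hterm : ∀ s, 0 ≤ Q s * klFun (P s / Q s) := fun s =>
    mul_nonneg (hQ0 s) (klFun_nonneg (div_nonneg (hP0 s) (hQ0 s)))
  have hb0 : 0 ≤ b := hQ.nonneg hQ0
  rcases hb0.eq_or_lt with hb | hb
  · rw [← hb, zero_mul]
    exact tsum_nonneg hterm
  have ha0 : 0 ≤ a := hP.nonneg hP0
  rcases ha0.eq_or_lt with ha | ha
  · -- `a = 0`: all `P s = 0`, both sides equal `b`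
    have hPz : P = 0 := (hasSum_zero_iff_of_nonneg hP0).1 (ha ▸ hP)
    have hQs : ∀ s, Q s * klFun (P s / Q s) = Q s := fun s => by simp [hPz, klFun]
    rw [← ha, zero_div, tsum_congr hQs, hQ.tsum_eq]
    simp [klFun]
  set c := a / b with hc
  have hc0 : 0 < c := div_pos ha hb
  have hlow : HasSum (fun s => Q s * klFun c + Real.log c * (P s - c * Q s))
      (b * klFun c + Real.log c * (a - c * b)) :=
    (hQ.mul_right (klFun c)).add ((hP.sub (hQ.mul_left c)).mul_left (Real.log c))
  have hle : ∀ s, Q s * klFun c + Real.log c * (P s - c * Q s) ≤ Q s * klFun (P s / Q s) := by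
    intro s
    rcases (hQ0 s).eq_or_lt with hQs | hQs
    · rw [← hQs, hac s hQs.symm]
      simp
    · rw [klFun_eq_tangent hc0 (P s / Q s)]
      have hrem : 0 ≤ Q s * (c * klFun (P s / Q s / c)) :=
        mul_nonneg hQs.le (mul_nonneg hc0.le (klFun_nonneg (div_nonneg (div_nonneg (hP0 s) hQs.le) hc0.le)))
      have e : Q s * (klFun c + Real.log c * (P s / Q s - c) + c * klFun (P s / Q s / c)) =
          Q s * klFun c + Real.log c * (P s - c * Q s) + Q s * (c * klFun (P s / Q s / c)) := by
        field_simp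
      rw [e]
      linarith
  have h := hasSum_le hle hlow hsum.hasSum
  have e2 : a - c * b = 0 := by
    rw [hc]
    field_simp
    ring
  rwa [e2, mul_zero, add_zero] at h

/-- `kl(a ‖ b) = b klFun(a/b) + (1-b) klFun((1-a)/(1-b))` for `b ∈ (0, 1)`: the binary relative
entropy in `klFun` currency (the `±(b - a)` corrections cancel). [folklore] -/
theorem binaryKL_eq_mul_klFun_add (a : ℝ) {b : ℝ} (hb : 0 < b) (hb1 : b < 1) :
    binaryKL a b = b * klFun (a / b) + (1 - b) * klFun ((1 - a) / (1 - b)) := by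
  have h1b : (0 : ℝ) < 1 - b := by linarith
  rw [binaryKL_def, klFun, klFun]
  field_simp
  ring

/-! ### Pinsker's inequality on a countable alphabet -/

/-- **Pinsker's inequality with the sharp constant** on a countable alphabet, `klFun` currency: for
probability vectors `p, q ≥ 0` (sums `1`) with `q s = 0 ⇒ p s = 0` and `Σ' q klFun(p/q) < ∞`,
`(Σ' |p - q|)² ≤ 2 Σ' q klFun(p / q)`. Proof: with `E = {q < p}`, `Σ'|p - q| = 2 (p(E) - q(E))`, the
log-sum inequality on `E` and `Eᶜ` gives `kl(p(E) ‖ q(E)) ≤ Σ' q klFun(p/q)`, and the sharp binary Pinsker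
inequality concludes. [folklore] -/
theorem sq_tsum_abs_sub_le {S : Type*} {p q : S → ℝ} (hp0 : ∀ s, 0 ≤ p s) (hq0 : ∀ s, 0 ≤ q s)
    (hp : HasSum p 1) (hq : HasSum q 1) (hac : ∀ s, q s = 0 → p s = 0)
    (hsum : Summable fun s => q s * klFun (p s / q s)) :
    (∑' s, |p s - q s|) ^ 2 ≤ 2 * ∑' s, q s * klFun (p s / q s) := by
  classical
  set E : Set S := {s | q s < p s} with hE
  set pE : S → ℝ := E.indicator p with hpE_def
  set qE : S → ℝ := E.indicator q with hqE_def
  set pE' : S → ℝ := Eᶜ.indicator p with hpE'_def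
  set qE' : S → ℝ := Eᶜ.indicator q with hqE'_def
  have hpE0 : ∀ s, 0 ≤ pE s := fun s => Set.indicator_nonneg (fun s _ => hp0 s) s
  have hqE0 : ∀ s, 0 ≤ qE s := fun s => Set.indicator_nonneg (fun s _ => hq0 s) s
  have hpE'0 : ∀ s, 0 ≤ pE' s := fun s => Set.indicator_nonneg (fun s _ => hp0 s) s
  have hqE'0 : ∀ s, 0 ≤ qE' s := fun s => Set.indicator_nonneg (fun s _ => hq0 s) s
  set a : ℝ := ∑' s, pE s with ha_def
  set b : ℝ := ∑' s, qE s with hb_def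
  have haE : HasSum pE a := (hp.summable.indicator E).hasSum
  have hbE : HasSum qE b := (hq.summable.indicator E).hasSum
  have haE' : HasSum pE' (1 - a) := by
    have h := hp.sub haE
    have e : (fun s => p s - pE s) = pE' := by
      funext s
      rw [hpE'_def, Set.indicator_compl]
      rfl
    rwa [e] at h
  have hbE' : HasSum qE' (1 - b) := by
    have h := hq.sub hbE
    have e : (fun s => q s - qE s) = qE' := by
      funext s
      rw [hqE'_def, Set.indicator_compl]
      rfl
    rwa [e] at h
  -- total variation in terms of `E`
  have htv : HasSum (fun s => |p s - q s|) (2 * (a - b)) := by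
    have h := (haE.sub hbE).add (hbE'.sub haE')
    have e1 : (fun s => pE s - qE s + (qE' s - pE' s)) = fun s => |p s - q s| := by
      funext s
      by_cases hs : s ∈ E
      · have hs' : s ∉ Eᶜ := fun h => h hs
        simp only [hpE_def, hqE_def, hpE'_def, hqE'_def, Set.indicator_of_mem hs,
          Set.indicator_of_notMem hs', sub_zero, add_zero]
        exact (abs_of_pos (sub_pos.2 hs)).symm
      · have hs' : s ∈ Eᶜ := hs
        have hle : p s ≤ q s := not_lt.1 hs
        simp only [hpE_def, hqE_def, hpE'_def, hqE'_def, Set.indicator_of_notMem hs,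
          Set.indicator_of_mem hs', sub_zero, zero_add]
        rw [abs_of_nonpos (sub_nonpos.2 hle)]
        ring
    have e2 : a - b + (1 - b - (1 - a)) = 2 * (a - b) := by ring
    rwa [e1, e2] at h
  rw [htv.tsum_eq]
  -- the divergence splits along `E`
  have hsplit : ∀ s, q s * klFun (p s / q s) =
      qE s * klFun (pE s / qE s) + qE' s * klFun (pE' s / qE' s) := by
    intro s
    by_cases hs : s ∈ E
    · have hs' : s ∉ Eᶜ := fun h => h hs
      simp [hpE_def, hqE_def, hpE'_def, hqE'_def, Set.indicator_of_mem hs, Set.indicator_of_notMem hs']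
    · have hs' : s ∈ Eᶜ := hs
      simp [hpE_def, hqE_def, hpE'_def, hqE'_def, Set.indicator_of_notMem hs, Set.indicator_of_mem hs']
  have hsumE : Summable fun s => qE s * klFun (pE s / qE s) := by
    have e : (fun s => qE s * klFun (pE s / qE s)) = E.indicator fun s => q s * klFun (p s / q s) := by
      funext s
      by_cases hs : s ∈ E
      · simp [hpE_def, hqE_def, Set.indicator_of_mem hs]
      · simp [hpE_def, hqE_def, Set.indicator_of_notMem hs]
    rw [e]
    exact hsum.indicator E
  have hsumE' : Summable fun s => qE' s * klFun (pE' s / qE' s) := by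
    have e : (fun s => qE' s * klFun (pE' s / qE' s)) = Eᶜ.indicator fun s => q s * klFun (p s / q s) := by
      funext s
      by_cases hs : s ∈ Eᶜ
      · simp [hpE'_def, hqE'_def, Set.indicator_of_mem hs]
      · simp [hpE'_def, hqE'_def, Set.indicator_of_notMem hs]
    rw [e]
    exact hsum.indicator Eᶜ
  have hD : ∑' s, q s * klFun (p s / q s) =
      ∑' s, qE s * klFun (pE s / qE s) + ∑' s, qE' s * klFun (pE' s / qE' s) := by
    rw [tsum_congr hsplit, hsumE.tsum_add hsumE']
  have hacE : ∀ s, qE s = 0 → pE s = 0 := by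
    intro s hs
    by_cases hsE : s ∈ E
    · simp only [hqE_def, hpE_def, Set.indicator_of_mem hsE] at hs ⊢
      exact hac s hs
    · simp [hpE_def, Set.indicator_of_notMem hsE]
  have hacE' : ∀ s, qE' s = 0 → pE' s = 0 := by
    intro s hs
    by_cases hsE : s ∈ Eᶜ
    · simp only [hqE'_def, hpE'_def, Set.indicator_of_mem hsE] at hs ⊢
      exact hac s hs
    · simp [hpE'_def, Set.indicator_of_notMem hsE]
  have hJ1 : b * klFun (a / b) ≤ ∑' s, qE s * klFun (pE s / qE s) :=
    mul_klFun_div_le_tsum hpE0 hqE0 haE hbE hacE hsumE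
  have hJ2 : (1 - b) * klFun ((1 - a) / (1 - b)) ≤ ∑' s, qE' s * klFun (pE' s / qE' s) :=
    mul_klFun_div_le_tsum hpE'0 hqE'0 haE' hbE' hacE' hsumE'
  have hDnonneg : 0 ≤ ∑' s, q s * klFun (p s / q s) :=
    tsum_nonneg fun s => mul_nonneg (hq0 s) (klFun_nonneg (div_nonneg (hp0 s) (hq0 s)))
  have ha0 : 0 ≤ a := haE.nonneg hpE0
  have ha1 : a ≤ 1 := by linarith [haE'.nonneg hpE'0]
  have hb0 : 0 ≤ b := hbE.nonneg hqE0
  have hb1 : b ≤ 1 := by linarith [hbE'.nonneg hqE'0]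
  -- degenerate case `b = 0`: then `a = 0`
  rcases hb0.eq_or_lt with hb | hb
  · have hqEz : qE = 0 := (hasSum_zero_iff_of_nonneg hqE0).1 (hb ▸ hbE)
    have hpEz : pE = 0 := funext fun s => hacE s (by simp [hqEz])
    have ha : a = 0 := by rw [ha_def, hpEz]; simp
    rw [ha, ← hb]
    simpa using hDnonneg
  -- degenerate case `b = 1`: then `a = 1`
  rcases hb1.lt_or_eq with hb' | hb'
  swap
  · have hqEz : qE' = 0 := (hasSum_zero_iff_of_nonneg hqE'0).1 (by simpa [hb'] using hbE')
    have hpEz : pE' = 0 := funext fun s => hacE' s (by simp [hqEz])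
    have ha : a = 1 := by
      have h : HasSum pE' 0 := by rw [hpEz]; exact hasSum_zero
      linarith [haE'.unique h]
    rw [ha, hb']
    simpa using hDnonneg
  -- main case `0 < b < 1`
  calc (2 * (a - b)) ^ 2 = 2 * (2 * (a - b) ^ 2) := by ring
    _ ≤ 2 * binaryKL a b := by
        gcongr
        exact two_mul_sq_sub_le_binaryKL ha0 ha1 hb hb'
    _ = 2 * (b * klFun (a / b) + (1 - b) * klFun ((1 - a) / (1 - b))) := by
        rw [binaryKL_eq_mul_klFun_add a hb hb']
    _ ≤ 2 * ∑' s, q s * klFun (p s / q s) := by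
        rw [hD]
        exact mul_le_mul_of_nonneg_left (add_le_add hJ1 hJ2) (by norm_num)

/-- Pinsker's inequality in square-root form: `Σ' |p - q| ≤ √(2 Σ' q klFun(p/q))`. [folklore] -/
theorem tsum_abs_sub_le_sqrt {S : Type*} {p q : S → ℝ} (hp0 : ∀ s, 0 ≤ p s) (hq0 : ∀ s, 0 ≤ q s)
    (hp : HasSum p 1) (hq : HasSum q 1) (hac : ∀ s, q s = 0 → p s = 0)
    (hsum : Summable fun s => q s * klFun (p s / q s)) :
    ∑' s, |p s - q s| ≤ Real.sqrt (2 * ∑' s, q s * klFun (p s / q s)) := by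
  have h := Real.abs_le_sqrt (sq_tsum_abs_sub_le hp0 hq0 hp hq hac hsum)
  rwa [abs_of_nonneg (tsum_nonneg fun s => abs_nonneg _)] at h

/-! ### The one-atom chain-rule identity -/

/-- **Chain-rule identity on one atom** (`klFun` currency). For nonnegative families `P', Q'` with sums
`P ≠ 0`, `Q ≠ 0`, `Q' s = 0 ⇒ P' s = 0`, and `Σ'_s Q'_s klFun(P'_s/Q'_s) = D`: the divergence of the
normalised vectors is `Σ'_s (Q'_s/Q) klFun((P'_s/P)/(Q'_s/Q)) = (D - Q klFun(P/Q)) / P`. Termwise: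
`P · (Q'/Q) klFun((P'/P)/(Q'/Q)) = Q' klFun(P'/Q') - Q'(1 - P/Q) - P' log(P/Q)`. [folklore] -/
theorem hasSum_cond_klFun {S : Type*} {P' Q' : S → ℝ} {P Q D : ℝ} (hP'0 : ∀ s, 0 ≤ P' s)
    (hQ'0 : ∀ s, 0 ≤ Q' s) (hP : HasSum P' P) (hQ : HasSum Q' Q) (hP0 : P ≠ 0) (hQ0 : Q ≠ 0)
    (hac : ∀ s, Q' s = 0 → P' s = 0) (hD : HasSum (fun s => Q' s * klFun (P' s / Q' s)) D) :
    HasSum (fun s => Q' s / Q * klFun (P' s / P / (Q' s / Q))) ((D - Q * klFun (P / Q)) / P) := by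
  have hterm : ∀ s, P * (Q' s / Q * klFun (P' s / P / (Q' s / Q))) =
      Q' s * klFun (P' s / Q' s) - Q' s * (1 - P / Q) - P' s * Real.log (P / Q) := by
    intro s
    rcases (hQ'0 s).eq_or_lt with hQs | hQs
    · rw [← hQs, hac s hQs.symm]
      simp
    rcases (hP'0 s).eq_or_lt with hPs | hPs
    · rw [← hPs]
      simp only [zero_div, klFun_zero, mul_one, zero_mul, sub_zero]
      field_simp
      ring
    · simp only [klFun]
      rw [Real.log_div (by positivity) (by positivity), Real.log_div hPs.ne' hP0,
        Real.log_div hQs.ne' hQ0, Real.log_div hPs.ne' hQs.ne', Real.log_div hP0 hQ0]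
      field_simp
      ring
  have hsum : HasSum (fun s => Q' s * klFun (P' s / Q' s) - Q' s * (1 - P / Q) - P' s * Real.log (P / Q))
      (D - Q * (1 - P / Q) - P * Real.log (P / Q)) :=
    (hD.sub (hQ.mul_right _)).sub (hP.mul_right _)
  have e1 : D - Q * (1 - P / Q) - P * Real.log (P / Q) = D - Q * klFun (P / Q) := by
    simp only [klFun]
    field_simp
    ring
  rw [e1] at hsum
  have h2 : HasSum (fun s => P * (Q' s / Q * klFun (P' s / P / (Q' s / Q)))) (D - Q * klFun (P / Q)) := by
    have e : (fun s => P * (Q' s / Q * klFun (P' s / P / (Q' s / Q)))) =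
        fun s => Q' s * klFun (P' s / Q' s) - Q' s * (1 - P / Q) - P' s * Real.log (P / Q) :=
      funext hterm
    rw [e]
    exact hsum
  have h3 := h2.div_const P
  have e3 : (fun s => P * (Q' s / Q * klFun (P' s / P / (Q' s / Q))) / P) =
      fun s => Q' s / Q * klFun (P' s / P / (Q' s / Q)) :=
    funext fun s => mul_div_cancel_left₀ _ hP0
  rwa [e3] at h3

end Summit.AtomisticToContinuum.HydrodynamicLimit.Theorems.EquilibriumForecastLine

end
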